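import Summits.HubbardSuperconductivity.HubbardSuperconductivity.Theorems.LevyLogBootstrapDressHalfFilledKernelXXZBond
import Literature.MathematicalPhysics.QuantumLattice.XYOrderDischarges
import HarnessLib

/-!
# Crux `DressHalfFilled` (stmt-HubbardSuperconductivity-8148, route `LevyLogBootstrap`; shared with route
# `AnisotropyChord` and, for stubs 1–2, with crux stmt-10291 `DressAnyFilling`): THE BOND SUM — Kato's kernels summed
# over the superlattice bonds ARE `2J · xxzHamiltonian 1 (torusGraph 2 M) (-1) Δ_eff + k(N_b)`, entrywise

Support file (`--supports stmt-HubbardSuperconductivity-8148`) for stub 2 (`stub_plaquetteDictionary`), clause (d). The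
previous file (`…KernelXXZBond`) identified ONE bond; this file performs the sum over the bonds of the plaquette torus
`torusGraph 2 M` and lands EXACTLY on the operator named in clause (d). For `U ∈ [2, 4]`, `J(U) ≠ 0` (part of (W1)),
`3 ≤ M` and product configurations `σ', σ : TorusSite 2 M → Fin 2` (up spin `0` at `R` = one hole pair on plaquette
`R`, `κ_R = (σ R).rev`):

  `Σ_R Σ_{i=0,1} [σ' = σ off {R, R+eᵢ}] · K(((σ' R).rev,(σ' (R+eᵢ)).rev), ((σ R).rev,(σ (R+eᵢ)).rev))`
  `= ⟨σ'| 2J(U) · xxzHamiltonian 1 (torusGraph 2 M) (-1) Δ_eff(U) |σ⟩ + [σ' = σ] · k(N_b(σ))`,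

a sum over the ORIENTED superlattice bonds `(R, R + eᵢ)` (cluster 1 `= R`, cluster 2 `= R + eᵢ`, the geometry of
`plaquetteBonds` / `plaquetteBondsV`), `K = plaquetteKernel U` (the SAME table on horizontal and vertical bonds,
`…KernelStructure`), with the explicit sector constant `k(N_b) = 2M² (Re K(0,0) - V/4) + 4 (μ + V/2) N_b`,
`N_b(σ) = #{R : σ R = 0}` (`dressHalfFilled_kernelXXZBondSum`).
The left-hand side is what the two-cluster locality of `T S(E₀) T` on the band product states produces bond by bond
(with a minus sign, `⟨κ'| T S T |κ⟩ = -K(κ', κ)`), so clause (d) is reduced to that locality statement.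

* `plaquetteKernel_swap_swap` — the table is symmetric under exchanging the two plaquettes of a bond,
  `K(κ'.swap, κ.swap) = K(κ', κ)` (`U ∈ [2,4]`), so the bond summand is a function on unordered bonds (`Sym2.lift`);
* `torus_affineBondSum` — `Σ_{bonds {x,y}} (c₀ + c₁ (g x + g y)) = 2M² c₀ + 4 c₁ Σ_x g x` on the `4`-regular torus
  `(ℤ/M)²`, `M ≥ 3` (`sum_pairs_eq_sum_edgeFinset` of `XYOrderDischarges` + translation invariance);
* `card_up_eq_sum_rev` — `Σ_R (σ R).rev = #{R : σ R = 0} = N_b`;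
* `torus_sum_pairs_eq_sum_edgeFinset_complex` — oriented-bond sums versus unordered-bond sums (complex-valued).

Registered sub-goal stub (signature verbatim at the end): `dressHalfFilled_kernelXXZBondSum`.

Sources: H. Yao, W.-F. Tsai, S. A. Kivelson, PRB 76 (2007) 161104(R), eq. (2) [YaoTsaiKivelson2007]; W.-F. Tsai,
S. A. Kivelson, PRB 73 (2006) 214510, App. A [TsaiKivelson2006]; H. Tasaki (2020), §2.4 (2.4.1) [Tasaki2020].
No definition and no named fact is introduced.
-/

noncomputable section

set_option linter.dupNamespace false

namespace Summit.HubbardSuperconductivity.HubbardSuperconductivity.Theorems.LevyLogBootstrap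

open Matrix Finset Complex Literature.MathematicalPhysics.QuantumLattice Literature.Probability.LatticeModels
open scoped ComplexOrder

section XXZBondSum

variable {U : ℝ}

/-! ### Exchange symmetry of the table -/

/-- The two-plaquette table is symmetric under exchanging the two plaquettes of the bond:
`K(κ'.swap, κ.swap) = K(κ', κ)`, `U ∈ [2, 4]` (diagonal: `plaquetteKernel_reflect`; exchange pair: both `-J`;
zeros: zeros). [cite: TsaiKivelson2006, App. A (A1)] -/
theorem plaquetteKernel_swap_swap (hU : U ∈ Set.Icc (2 : ℝ) 4) (κ' κ : Fin 2 × Fin 2) :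
    plaquetteKernel U κ'.swap κ.swap = plaquetteKernel U κ' κ := by
  have hx : plaquetteKernel U (0, 1) (1, 0) = plaquetteKernel U (1, 0) (0, 1) := by
    rw [plaquetteKernel_hop'_eq_neg_J hU, plaquetteKernel_hop_eq_neg_J hU]
  by_cases h1 : κ' = κ
  · subst h1
    rcases κ' with ⟨k, l⟩
    exact (plaquetteKernel_reflect hU k l).symm
  · by_cases h2 : κ'.1 ≠ κ'.2 ∧ κ = κ'.swap
    · obtain ⟨hne, rfl⟩ := h2
      rw [Prod.swap_swap]
      rcases κ' with ⟨a, b⟩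
      simp only [Prod.swap_prod_mk]
      fin_cases a <;> fin_cases b
      · exact absurd rfl hne
      · exact hx.symm
      · exact hx
      · exact absurd rfl hne
    · rw [plaquetteKernel_eq_zero U _ _ h1 h2, plaquetteKernel_eq_zero U _ _ (fun h => h1 (Prod.swap_injective h))]
      rintro ⟨hne, heq⟩
      refine h2 ⟨fun h => hne h.symm, ?_⟩
      rw [← Prod.swap_swap κ, heq, Prod.swap_swap]

/-! ### Bookkeeping on the torus `(ℤ/M)²` -/

/-- **Affine bond sums on the `4`-regular torus**: for `M ≥ 3`,
`Σ_{bonds {x,y} of (ℤ/M)²} (c₀ + c₁ (g x + g y)) = 2M² c₀ + 4 c₁ Σ_x g x` (there are `2M²` bonds and every site lies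
on `4` of them). [folklore] -/
theorem torus_affineBondSum (M : ℕ) [NeZero M] (hM : 3 ≤ M) (c₀ c₁ : ℝ) (g : TorusSite 2 M → ℝ) :
    ∑ e ∈ (torusGraph 2 M).edgeFinset,
        Sym2.lift ⟨fun x y => c₀ + c₁ * (g x + g y), fun x y => by ring⟩ e =
      2 * (M : ℝ) ^ 2 * c₀ + 4 * c₁ * ∑ x, g x := by
  have h := sum_pairs_eq_sum_edgeFinset (d := 2) M (by omega)
    (fun e => Sym2.lift ⟨fun x y => c₀ + c₁ * (g x + g y), fun x y => by ring⟩ e)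
  rw [if_neg (by omega : M ≠ 2), one_mul] at h
  rw [← h]
  simp only [Sym2.lift_mk]
  have hcard : Fintype.card (TorusSite 2 M) = M ^ 2 := by
    rw [Fintype.card_fun, ZMod.card, Fintype.card_fin]
  have htrans : ∀ i : Fin 2, ∑ x : TorusSite 2 M, g (x + Pi.single i 1) = ∑ x, g x := fun i =>
    Fintype.sum_equiv (Equiv.addRight (Pi.single i (1 : ZMod M))) (fun x => g (x + Pi.single i 1)) g
      fun _ => rfl
  have e1 : ∀ x : TorusSite 2 M, ∑ i : Fin 2, (c₀ + c₁ * (g x + g (x + Pi.single i 1))) =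
      2 * c₀ + 2 * c₁ * g x + c₁ * ∑ i : Fin 2, g (x + Pi.single i 1) := by
    intro x
    rw [Fin.sum_univ_two, Fin.sum_univ_two]
    ring
  have e2 : ∑ x : TorusSite 2 M, ∑ i : Fin 2, g (x + Pi.single i 1) = 2 * ∑ x, g x := by
    rw [Finset.sum_comm, Fin.sum_univ_two, htrans 0, htrans 1]
    ring
  calc ∑ x : TorusSite 2 M, ∑ i : Fin 2, (c₀ + c₁ * (g x + g (x + Pi.single i 1)))
      = ∑ x : TorusSite 2 M, (2 * c₀ + 2 * c₁ * g x + c₁ * ∑ i : Fin 2, g (x + Pi.single i 1)) :=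
        Finset.sum_congr rfl fun x _ => e1 x
    _ = 2 * c₀ * (M : ℝ) ^ 2 + 2 * c₁ * ∑ x, g x + c₁ * ∑ x : TorusSite 2 M, ∑ i : Fin 2, g (x + Pi.single i 1) := by
        rw [Finset.sum_add_distrib, Finset.sum_add_distrib, Finset.sum_const, Finset.card_univ, hcard,
          ← Finset.mul_sum, ← Finset.mul_sum, nsmul_eq_mul]
        push_cast
        ring
    _ = 2 * (M : ℝ) ^ 2 * c₀ + 4 * c₁ * ∑ x, g x := by
        rw [e2]
        ring

/-- The number of up spins (`σ R = 0`, i.e. hole pairs) as the sum of the reversed indices: `Σ_R (σ R).rev = N_b(σ)`.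
[folklore] -/
theorem card_up_eq_sum_rev {Λ : Type*} [Fintype Λ] (σ : TensorIndex Λ 2) :
    ∑ x, (((σ x).rev : ℕ) : ℝ) = ((Finset.univ.filter fun x => σ x = 0).card : ℝ) := by
  have h : ∀ k : Fin 2, ((k.rev : ℕ) : ℝ) = if k = 0 then 1 else 0 := by
    intro k
    fin_cases k <;> simp
  simp only [h, Finset.sum_boole]

/-! ### The bond sum -/

/-- Sums over the ORIENTED bonds `(x, x + eᵢ)` of `(ℤ/M)²`, `M ≥ 3`, versus sums over unordered bonds, for
complex-valued bond functions (the real case is `sum_pairs_eq_sum_edgeFinset`). [folklore] -/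
theorem torus_sum_pairs_eq_sum_edgeFinset_complex (M : ℕ) [NeZero M] (hM : 3 ≤ M)
    (G : Sym2 (TorusSite 2 M) → ℂ) :
    ∑ x : TorusSite 2 M, ∑ i : Fin 2, G s(x, x + Pi.single i 1) = ∑ e ∈ (torusGraph 2 M).edgeFinset, G e := by
  apply Complex.ext
  · have h := sum_pairs_eq_sum_edgeFinset (d := 2) M (by omega) (fun e => (G e).re)
    rw [if_neg (by omega : M ≠ 2), one_mul] at h
    simpa only [Complex.re_sum] using h
  · have h := sum_pairs_eq_sum_edgeFinset (d := 2) M (by omega) (fun e => (G e).im)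
    rw [if_neg (by omega : M ≠ 2), one_mul] at h
    simpa only [Complex.im_sum] using h

/-- **THE DICTIONARY, OPERATOR FORM ON THE SPIN SIDE** (`U ∈ [2, 4]`, `J(U) ≠ 0`, `M ≥ 3`): summing Kato's two-plaquette
kernel over the ORIENTED superlattice bonds `(R, R + eᵢ)` (cluster 1 `= R`, cluster 2 `= R + eᵢ`; `i = 0` horizontal,
`i = 1` vertical — the same table `plaquetteKernel U` on both, `…KernelStructure`) gives the XXZ Hamiltonian named in
clause (d) plus the sector constant: for all product configurations `σ', σ : TorusSite 2 M → Fin 2`,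
`Σ_R Σ_i [σ' = σ off {R, R+eᵢ}] · K(((σ' R).rev,(σ' (R+eᵢ)).rev),((σ R).rev,(σ (R+eᵢ)).rev))
 = ⟨σ'| 2J · xxzHamiltonian 1 (torusGraph 2 M) (-1) Δ_eff |σ⟩ + [σ' = σ] · (2M²(Re K(0,0) - V/4) + 4(μ + V/2) N_b(σ))`,
`N_b(σ) = #{R : σ R = 0}` (up spin = hole pair). The JW/embedding half — that `⟨Ω_{κ'}| T S(E₀) T |Ω_κ⟩` is minus the
left-hand side on the band product states — is the remaining two-cluster locality statement of stub 2.
[cite: YaoTsaiKivelson2007, eq. (2)] -/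
theorem plaquetteKernel_bondSum_eq_xxz (hU : U ∈ Set.Icc (2 : ℝ) 4) (hJ : (plaquettePairCouplings U).J ≠ 0)
    (M : ℕ) [NeZero M] (hM : 3 ≤ M) (σ' σ : TensorIndex (TorusSite 2 M) 2) :
    ∑ x : TorusSite 2 M, ∑ i : Fin 2,
        (if (∀ z, z ≠ x → z ≠ x + Pi.single i 1 → σ' z = σ z) then
          plaquetteKernel U ((σ' x).rev, (σ' (x + Pi.single i 1)).rev) ((σ x).rev, (σ (x + Pi.single i 1)).rev)
        else 0) =
      ((((2 * (plaquettePairCouplings U).J : ℝ) : ℂ)) •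
          xxzHamiltonian 1 (torusGraph 2 M) (-1) (plaquettePairCouplings U).ΔEff) σ' σ +
        (if σ' = σ then
          (((2 * (M : ℝ) ^ 2 * ((plaquetteKernel U (0, 0) (0, 0)).re - (plaquettePairCouplings U).V / 4) +
              4 * ((plaquettePairCouplings U).μ + (plaquettePairCouplings U).V / 2) *
                ((Finset.univ.filter fun x => σ x = 0).card : ℝ) : ℝ) : ℂ))
        else 0) := by
  set C := plaquettePairCouplings U with hC
  set c₀ : ℝ := (plaquetteKernel U (0, 0) (0, 0)).re - C.V / 4 with hc₀
  set c₁ : ℝ := C.μ + C.V / 2 with hc₁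
  set g : TorusSite 2 M → ℝ := fun x => (((σ x).rev : ℕ) : ℝ) with hg
  -- the bond summand as a function on unordered bonds (symmetric by `plaquetteKernel_swap_swap`)
  set F : Sym2 (TorusSite 2 M) → ℂ := Sym2.lift
    ⟨fun x y => if (∀ z, z ≠ x → z ≠ y → σ' z = σ z) then
        plaquetteKernel U ((σ' x).rev, (σ' y).rev) ((σ x).rev, (σ y).rev) else 0,
      fun x y => by
        dsimp only
        have hc : (∀ z, z ≠ x → z ≠ y → σ' z = σ z) ↔ (∀ z, z ≠ y → z ≠ x → σ' z = σ z) :=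
          forall_congr' fun z => imp.swap
        rw [if_congr hc rfl rfl, ← plaquetteKernel_swap_swap hU ((σ' y).rev, (σ' x).rev)
          ((σ y).rev, (σ x).rev), Prod.swap_prod_mk, Prod.swap_prod_mk]⟩ with hF
  -- the XXZ bond operator and the affine diagonal, as functions on unordered bonds
  set XB : Sym2 (TorusSite 2 M) → Op (TorusSite 2 M) 2 := Sym2.lift
    ⟨fun x y => spinBond 1 0 x y + spinBond 1 1 x y + ((C.ΔEff : ℝ) : ℂ) • spinBond 1 2 x y,
      fun x y => by simp only [spinBond_comm]⟩ with hXB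
  set AB : Sym2 (TorusSite 2 M) → ℂ := Sym2.lift
    ⟨fun x y => if σ' = σ then (((c₀ + c₁ * (g x + g y) : ℝ)) : ℂ) else 0, fun x y => by
      simp only [add_comm (g x) (g y)]⟩ with hAB
  -- (0) the oriented bond sum is the sum of `F` over the bonds
  have hL : ∑ x : TorusSite 2 M, ∑ i : Fin 2,
        (if (∀ z, z ≠ x → z ≠ x + Pi.single i 1 → σ' z = σ z) then
          plaquetteKernel U ((σ' x).rev, (σ' (x + Pi.single i 1)).rev) ((σ x).rev, (σ (x + Pi.single i 1)).rev)
        else 0) = ∑ e ∈ (torusGraph 2 M).edgeFinset, F e := by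
    rw [← torus_sum_pairs_eq_sum_edgeFinset_complex M hM F]
    simp only [hF, Sym2.lift_mk]
  -- (1) the Hamiltonian entry as a bond sum
  have hH : ((((2 * C.J : ℝ) : ℂ)) • xxzHamiltonian 1 (torusGraph 2 M) (-1) C.ΔEff) σ' σ =
      -(((2 * C.J : ℝ) : ℂ)) * ∑ e ∈ (torusGraph 2 M).edgeFinset, XB e σ' σ := by
    rw [Matrix.smul_apply, smul_eq_mul, xxzHamiltonian, Matrix.smul_apply, smul_eq_mul, Matrix.sum_apply]
    push_cast
    ring
  -- (2) the per-bond identity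
  have hedge : ∀ e ∈ (torusGraph 2 M).edgeFinset, F e = -(((2 * C.J : ℝ) : ℂ)) * XB e σ' σ + AB e := by
    intro e he
    induction e using Sym2.ind with
    | h x y =>
      have hxy : x ≠ y := (torusGraph 2 M).ne_of_adj (SimpleGraph.mem_edgeFinset.1 he)
      simp only [Sym2.lift_mk, hF, hXB, hAB]
      by_cases h : ∀ z, z ≠ x → z ≠ y → σ' z = σ z
      · have key := spinBond_xxzΔ_apply_eq_plaquetteKernel hU hJ hxy σ' σ h
        rw [Matrix.smul_apply, smul_eq_mul, ← hC] at key
        rw [if_pos h, neg_mul, key]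
        by_cases hs : σ' = σ
        · rw [if_pos hs, if_pos hs, hs]
          ring
        · rw [if_neg hs, if_neg hs]
          ring
      · have hs : σ' ≠ σ := fun hs => h fun z _ _ => by rw [hs]
        rw [if_neg h, if_neg hs]
        simp only [Matrix.add_apply, Matrix.smul_apply, smul_eq_mul, spinBond_apply_of_ne 1 _ hxy, if_neg h]
        ring
  -- (3) the affine diagonal summed over the bonds
  have hA : ∑ e ∈ (torusGraph 2 M).edgeFinset, AB e =
      if σ' = σ then (((2 * (M : ℝ) ^ 2 * c₀ + 4 * c₁ * ((Finset.univ.filter fun x => σ x = 0).card : ℝ) : ℝ)) : ℂ)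
      else 0 := by
    by_cases hs : σ' = σ
    · rw [if_pos hs, ← card_up_eq_sum_rev σ, ← torus_affineBondSum M hM c₀ c₁ g, Complex.ofReal_sum]
      refine Finset.sum_congr rfl fun e _ => ?_
      induction e using Sym2.ind with
      | h x y => simp only [hAB, Sym2.lift_mk, if_pos hs]
    · rw [if_neg hs]
      refine Finset.sum_eq_zero fun e _ => ?_
      induction e using Sym2.ind with
      | h x y => simp only [hAB, Sym2.lift_mk, if_neg hs]
  rw [hL, Finset.sum_congr rfl hedge, Finset.sum_add_distrib, ← Finset.mul_sum, hA, hH]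

end XXZBondSum

/-! ### Registered sub-goal stub of stmt-HubbardSuperconductivity-8148 (signature verbatim) -/

/-- Registered sub-goal `dressHalfFilled_kernelXXZBondSum` (clause (d) of the dictionary, spin side, operator level): for
`U ∈ [2,4]`, `J(U) ≠ 0`, `M ≥ 3`, the two-plaquette kernels summed over the oriented superlattice bonds `(R, R + eᵢ)` of
`(ℤ/M)²` are the matrix elements of `2J · xxzHamiltonian 1 (torusGraph 2 M) (-1) Δ_eff` plus the sector constant
`2M²(Re K(0,0) - V/4) + 4(μ + V/2) N_b`. [cite: YaoTsaiKivelson2007, eq. (2)] -/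
theorem dressHalfFilled_kernelXXZBondSum : ∀ {U : ℝ}, U ∈ Set.Icc (2 : ℝ) 4 → (Literature.MathematicalPhysics.QuantumLattice.plaquettePairCouplings U).J ≠ 0 → ∀ (M : ℕ) [NeZero M], 3 ≤ M → ∀ σ' σ : Literature.MathematicalPhysics.QuantumLattice.TensorIndex (Literature.Probability.LatticeModels.TorusSite 2 M) 2, (∑ x : Literature.Probability.LatticeModels.TorusSite 2 M, ∑ i : Fin 2, (if (∀ z, z ≠ x → z ≠ x + Pi.single i 1 → σ' z = σ z) then Literature.MathematicalPhysics.QuantumLattice.plaquetteKernel U ((σ' x).rev, (σ' (x + Pi.single i 1)).rev) ((σ x).rev, (σ (x + Pi.single i 1)).rev) else 0)) = ((((2 * (Literature.MathematicalPhysics.QuantumLattice.plaquettePairCouplings U).J : ℝ) : ℂ)) • Literature.MathematicalPhysics.QuantumLattice.xxzHamiltonian 1 (Literature.Probability.LatticeModels.torusGraph 2 M) (-1) (Literature.MathematicalPhysics.QuantumLattice.plaquettePairCouplings U).ΔEff) σ' σ + (if σ' = σ then (((2 * (M : ℝ) ^ 2 * ((Literature.MathematicalPhysics.QuantumLattice.plaquetteKernel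 U (0, 0) (0, 0)).re - (Literature.MathematicalPhysics.QuantumLattice.plaquettePairCouplings U).V / 4) + 4 * ((Literature.MathematicalPhysics.QuantumLattice.plaquettePairCouplings U).μ + (Literature.MathematicalPhysics.QuantumLattice.plaquettePairCouplings U).V / 2) * ((Finset.univ.filter fun x => σ x = 0).card : ℝ) : ℝ) : ℂ)) else 0) :=
  fun hU hJ M _ hM σ' σ => plaquetteKernel_bondSum_eq_xxz hU hJ M hM σ' σ

end Summit.HubbardSuperconductivity.HubbardSuperconductivity.Theorems.LevyLogBootstrap

end
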